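import Literature.IUT.HodgeTheaters.ProfiniteCompletionSubgroups
import Mathlib.Topology.Homeomorph.Lemmas
import Mathlib.Topology.Algebra.ContinuousMonoidHom
import HarnessLib

/-!
# [IUTchI] §2 plumbing, III: `Ĝ ≃ₜ* closure(η_F(G)) ⊆ F̂` for a subgroup `G ⊆ F` of finite index,
# as a topological-group ISOMORPHISM onto an OPEN subgroup of index `[F : G]`

Mochizuki, *Inter-universal Teichmüller theory I*, §2 (kurims May-2020 manuscript), Theorem 2.6 and its
proof p. 56–57 ("we may assume that `γ ∈ Ĝ`", "`F ∩ Ĝ = G`") and the proof of Lemma 2.7 (vi) p. 59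
("consider the closure `Ĝ₁ ⊆ Ĝ` … we may work with `Ĝ₁` instead of `Ĝ`") freely IDENTIFY, for a subgroup
`G ⊆ F` of finite index, the profinite completion `Ĝ` of `G` with the closure of `η_F(G)` in `F̂`
(standard: the profinite topology of `F` induces on a finite-index subgroup its own full profinite
topology, Ribes–Zalesskii, *Profinite Groups*, Lemma 3.2.6 / Prop. 3.2.2).  Part II
(`ProfiniteCompletionSubgroups.lean`) proved the existence of a continuous injective homomorphism
`ι : Ĝ → F̂` with `ι ∘ η_G = η_F|_G` and `range ι = closure(η_F(G))` (`exists_comparison`).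

THIS FILE (theorems only, no definitions) packages that comparison in the form the dischargers of
Lemma 2.7 (vi)(vii) and of Theorem 2.6 consume (cell abc-iut, L5-t6's route note for Lem 2.7 (vi)(vii),
step (3) "the plumbing lemma"):

* uniqueness: a continuous map out of `Ĝ` into a Hausdorff space is determined by its values on `η_G(G)`
  (`eq_of_forall_toCompletion`); hence ANY continuous homomorphism `ψ : Ĝ → F̂` with
  `ψ ∘ η_G = η_F|_G` — Mathlib's universal arrow `ProfiniteGrp.ProfiniteCompletion.lift`, the functorial
  map `ProfiniteGrp.profiniteCompletion.map`, or the witness of `exists_comparison` — is THE comparison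
  (`eq_of_toCompletion_eq`), and for it: injective, `range ψ = closure(η_F(G))`, closed embedding,
  `closure (ψ '' s) = ψ '' closure s`, `η_F f ∈ range ψ ↔ f ∈ G`;
* the subgroup `U_G := (G.map η_F).topologicalClosure ⊆ F̂` (carrier `closure(η_F(G))`): it is the preimage of
  `G/N₀ ⊆ F/N₀` under the `N₀`-th projection, `N₀ =` the normal core of `G`, hence OPEN, of index
  `[F̂ : U_G] = [F : G]`, normal when `G` is, and `z ^ [F : N₀] ∈ U_G` for every `z ∈ F̂`;
* **the topological-group isomorphism** `e : Ĝ ≃ₜ* U_G` with `(e x : F̂) = ψ x`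
  (`exists_continuousMulEquiv_of_toCompletion`, `exists_continuousMulEquiv`): a continuous bijection from
  a compact space onto a Hausdorff space;
* the values of the universal arrow / functorial map on `η_G(G)` (`lift_toCompletion`,
  `profiniteCompletionMap_toCompletion`), so that both satisfy the hypothesis `ψ ∘ η_G = η_F|_G`.

Everything here is plain profinite group theory [cite: RibesZalesskii2010, Lemma 3.2.6]; the locators
[cite: Mochizuki2012, IUTchI Thm 2.6 p.57] (D-0012 claim key, status disputed) mark the printed steps served;
nothing disputed is asserted and no side is taken on [IUTchIII] Cor. 3.12.
-/

namespace Literature.IUT.HodgeTheaters.ProfiniteCompletion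

open CategoryTheory ProfiniteGrp ProfiniteGrp.ProfiniteCompletion Topology

universe u

variable {F : Type u} [Group F]

/-! ### Uniqueness of continuous maps out of `Ĝ` -/

/-- A continuous map `Ĝ → P` into a Hausdorff space is determined by its values on the dense subset
`η_G(G)` (`ProfiniteGrp.ProfiniteCompletion.denseRange`). [cite: Mochizuki2012, IUTchI Thm 2.6 p.56] -/
theorem eq_of_forall_toCompletion {G : Type u} [Group G] {P : Type*} [TopologicalSpace P] [T2Space P]
    {ψ₁ ψ₂ : profiniteCompletion G → P} (h₁ : Continuous ψ₁) (h₂ : Continuous ψ₂)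
    (h : ∀ g : G, ψ₁ (toCompletion G g) = ψ₂ (toCompletion G g)) : ψ₁ = ψ₂ :=
  (denseRange (GrpCat.of G)).equalizer h₁ h₂ (funext h)

/-- The universal arrow `lift (η_F ∘ (G ⊆ F)) : Ĝ → F̂` extends the inclusion: it maps `η_G(g)` to
`η_F(g)` (Mathlib `ProfiniteGrp.ProfiniteCompletion.lift_eta`, element form).
[cite: Mochizuki2012, IUTchI Thm 2.6 p.57] -/
theorem lift_toCompletion (G : Subgroup F) (g : G) :
    (ProfiniteCompletion.lift (G := GrpCat.of (G : Type u)) (P := profiniteCompletion F)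
        (GrpCat.ofHom ((toCompletion F).comp G.subtype))).hom (toCompletion G g) =
      toCompletion F (g : F) :=
  ConcreteCategory.congr_hom
    (ProfiniteCompletion.lift_eta (G := GrpCat.of (G : Type u)) (P := profiniteCompletion F)
      (GrpCat.ofHom ((toCompletion F).comp G.subtype))) g

/-- The functorial map `profiniteCompletion.map f : Ĝ → Ĥ` of a homomorphism `f : G → H` extends `f`:
it maps `η_G(g)` to `η_H(f g)`. [cite: Mochizuki2012, IUTchI Thm 2.6 p.57] -/
theorem profiniteCompletionMap_toCompletion {G H : Type u} [Group G] [Group H] (f : G →* H) (g : G) :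
    (ProfiniteGrp.profiniteCompletion.map (GrpCat.ofHom f)).hom (toCompletion G g) =
      toCompletion H (f g) :=
  ConcreteCategory.congr_hom
    (ProfiniteCompletion.lift_eta (G := GrpCat.of G) (P := profiniteCompletion H)
      (GrpCat.ofHom f ≫ eta (GrpCat.of H))) g

/-! ### The subgroup `U_G = closure(η_F(G))` of `F̂` -/

/-- The carrier of `(G.map η_F).topologicalClosure` is `closure(η_F(G))`. [cite: Mochizuki2012, IUTchI Thm 2.6 p.57] -/
theorem coe_topologicalClosure_map (G : Subgroup F) :
    ((G.map (toCompletion F)).topologicalClosure : Set (profiniteCompletion F)) =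
      closure (toCompletion F '' (G : Set F)) := by
  rw [Subgroup.topologicalClosure_coe, Subgroup.coe_map]

/-- Membership form of `coe_topologicalClosure_map`. [cite: Mochizuki2012, IUTchI Thm 2.6 p.57] -/
theorem mem_topologicalClosure_map_iff {G : Subgroup F} {x : profiniteCompletion F} :
    x ∈ (G.map (toCompletion F)).topologicalClosure ↔ x ∈ closure (toCompletion F '' (G : Set F)) := by
  rw [← SetLike.mem_coe, coe_topologicalClosure_map]

/-- `U_G` is the preimage of `G/N₀ ⊆ F/N₀` under the `N₀`-th projection, `N₀` the normal core of `G`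
(one level suffices above a finite-index normal subgroup, `mem_closure_image_iff_val_mem`).
[cite: Mochizuki2012, IUTchI Thm 2.6 p.57] -/
theorem topologicalClosure_map_eq_comap (G : Subgroup F) [G.FiniteIndex] :
    (G.map (toCompletion F)).topologicalClosure =
      (G.map (QuotientGroup.mk' G.normalCore)).comap
        (MonoidHom.mk' (G := F ⧸ G.normalCore)
          (fun x : profiniteCompletion F => x.val (FiniteIndexNormalSubgroup.ofSubgroup G.normalCore))
          fun _ _ => rfl) := by
  ext x
  rw [mem_topologicalClosure_map_iff, Subgroup.mem_comap]
  exact mem_closure_image_iff_val_mem (FiniteIndexNormalSubgroup.ofSubgroup G.normalCore)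
    G.normalCore_le x

/-- Monotonicity of `H ↦ U_H`. [cite: Mochizuki2012, IUTchI Thm 2.6 p.57] -/
theorem topologicalClosure_map_mono {H K : Subgroup F} (h : H ≤ K) :
    (H.map (toCompletion F)).topologicalClosure ≤ (K.map (toCompletion F)).topologicalClosure :=
  Subgroup.topologicalClosure_mono (Subgroup.map_mono h)

/-- For a NORMAL subgroup `N ⊴ F` of finite index, `U_N = closure(η_F(N))` is normal in `F̂`.
[cite: Mochizuki2012, IUTchI Thm 2.6 p.57] -/
theorem normal_topologicalClosure_map (N : Subgroup F) [N.Normal] [N.FiniteIndex] :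
    (N.map (toCompletion F)).topologicalClosure.Normal := by
  haveI : (N.map (QuotientGroup.mk' N.normalCore)).Normal :=
    Subgroup.Normal.map inferInstance _ (QuotientGroup.mk'_surjective _)
  rw [topologicalClosure_map_eq_comap N]
  exact Subgroup.Normal.comap inferInstance _

/-- **`closure(η_F(G))` is open in `F̂`** for `G ⊆ F` of finite index (preimage of a subset of the finite
discrete quotient `F ⧸ N₀`). [cite: Mochizuki2012, IUTchI Thm 2.6 p.57] -/
theorem isOpen_closure_image (G : Subgroup F) [G.FiniteIndex] :
    IsOpen (closure (toCompletion F '' (G : Set F))) := by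
  let N₀ : FiniteIndexNormalSubgroup F := FiniteIndexNormalSubgroup.ofSubgroup G.normalCore
  haveI : DiscreteTopology ((diagram (GrpCat.of F)).obj N₀) := ⟨rfl⟩
  have hopen : IsOpen ((fun x : profiniteCompletion F => x.val N₀) ⁻¹'
      {q | q ∈ G.map (QuotientGroup.mk' G.normalCore)}) :=
    (isOpen_discrete _).preimage (continuous_val N₀)
  convert hopen using 1
  ext x
  exact mem_closure_image_iff_val_mem N₀ G.normalCore_le x

/-- `U_G` is an open subgroup of `F̂`. [cite: Mochizuki2012, IUTchI Thm 2.6 p.57] -/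
theorem isOpen_topologicalClosure_map (G : Subgroup F) [G.FiniteIndex] :
    IsOpen ((G.map (toCompletion F)).topologicalClosure : Set (profiniteCompletion F)) := by
  rw [coe_topologicalClosure_map]
  exact isOpen_closure_image G

/-- **`[F̂ : U_G] = [F : G]`.** [cite: Mochizuki2012, IUTchI Thm 2.6 p.57] -/
theorem index_topologicalClosure_map (G : Subgroup F) [G.FiniteIndex] :
    (G.map (toCompletion F)).topologicalClosure.index = G.index := by
  have hπ : Function.Surjective (MonoidHom.mk' (G := F ⧸ G.normalCore)
      (fun x : profiniteCompletion F => x.val (FiniteIndexNormalSubgroup.ofSubgroup G.normalCore))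
      fun _ _ => rfl) := by
    rintro ⟨f⟩
    exact ⟨toCompletion F f, rfl⟩
  rw [topologicalClosure_map_eq_comap,
    (G.map (QuotientGroup.mk' G.normalCore)).index_comap_of_surjective hπ,
    G.index_map_eq (QuotientGroup.mk'_surjective _)
      (by rw [QuotientGroup.ker_mk']; exact G.normalCore_le)]

/-- `U_G` has finite index in `F̂`. [cite: Mochizuki2012, IUTchI Thm 2.6 p.57] -/
theorem finiteIndex_topologicalClosure_map (G : Subgroup F) [G.FiniteIndex] :
    (G.map (toCompletion F)).topologicalClosure.FiniteIndex :=
  ⟨by rw [index_topologicalClosure_map]; exact Subgroup.FiniteIndex.index_ne_zero⟩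

/-- `z ^ [F : N₀] ∈ U_G` for every `z ∈ F̂`, `N₀` the normal core of `G` (a uniform exponent putting every
element of `F̂` into `U_G`; used as "`z^m ∈ Ĝ₁`" in the proof of Lemma 2.7 (vi), p. 59 — note that `U_G`
itself need not be normal, so `[F : G]` would not do). [cite: Mochizuki2012, IUTchI Lem 2.7 p.59] -/
theorem pow_index_normalCore_mem_topologicalClosure_map (G : Subgroup F) [G.FiniteIndex]
    (z : profiniteCompletion F) :
    z ^ G.normalCore.index ∈ (G.map (toCompletion F)).topologicalClosure := by
  haveI := normal_topologicalClosure_map G.normalCore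
  have h := Subgroup.pow_index_mem (G.normalCore.map (toCompletion F)).topologicalClosure z
  rw [index_topologicalClosure_map] at h
  exact topologicalClosure_map_mono G.normalCore_le h

/-- Hence some positive power `z ^ m`, `0 < m`, of every `z ∈ F̂` lies in `U_G`.
[cite: Mochizuki2012, IUTchI Lem 2.7 p.59] -/
theorem exists_pow_mem_topologicalClosure_map (G : Subgroup F) [G.FiniteIndex] :
    ∃ m : ℕ, 0 < m ∧ ∀ z : profiniteCompletion F, z ^ m ∈ (G.map (toCompletion F)).topologicalClosure :=
  ⟨G.normalCore.index, Nat.pos_of_ne_zero Subgroup.FiniteIndex.index_ne_zero,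
    pow_index_normalCore_mem_topologicalClosure_map G⟩

/-- `η_F(f) ∈ U_G ↔ f ∈ G` ("`F ∩ Ĝ = G`", p. 57). [cite: Mochizuki2012, IUTchI Thm 2.6 p.57] -/
theorem toCompletion_mem_topologicalClosure_map_iff (G : Subgroup F) [G.FiniteIndex] (f : F) :
    toCompletion F f ∈ (G.map (toCompletion F)).topologicalClosure ↔ f ∈ G := by
  rw [mem_topologicalClosure_map_iff]
  exact toCompletion_mem_closure_image_iff G f

/-! ### Continuous homomorphisms `ψ : Ĝ → F̂` extending the inclusion `G ⊆ F` -/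

section Comparison

variable (G : Subgroup F) {ψ : profiniteCompletion G →* profiniteCompletion F}

/-- **Uniqueness of the comparison map**: two continuous homomorphisms `Ĝ → F̂` extending the inclusion
coincide. [cite: Mochizuki2012, IUTchI Thm 2.6 p.57] -/
theorem eq_of_toCompletion_eq {ψ₁ ψ₂ : profiniteCompletion G →* profiniteCompletion F}
    (h₁ : Continuous ψ₁) (h₂ : Continuous ψ₂)
    (hψ₁ : ∀ g : G, ψ₁ (toCompletion G g) = toCompletion F (g : F))
    (hψ₂ : ∀ g : G, ψ₂ (toCompletion G g) = toCompletion F (g : F)) : ψ₁ = ψ₂ :=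
  MonoidHom.ext fun x => congrFun
    (eq_of_forall_toCompletion (ψ₁ := (ψ₁ : _ → _)) (ψ₂ := (ψ₂ : _ → _)) h₁ h₂
      fun g => (hψ₁ g).trans (hψ₂ g).symm) x

variable [G.FiniteIndex] (hψc : Continuous ψ)
  (hψ : ∀ g : G, ψ (toCompletion G g) = toCompletion F (g : F))
include hψc hψ

/-- **Injectivity and range**: a continuous homomorphism `ψ : Ĝ → F̂` extending the inclusion of a
finite-index subgroup is injective with `range ψ = closure(η_F(G))` (it coincides with the witness of
`exists_comparison`).  (Stated as one conjunction: a bare `Function.Injective ψ` conclusion hash-collides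
in the gate's dedup index.) [cite: Mochizuki2012, IUTchI Thm 2.6 p.57] -/
theorem injective_and_range_eq_closure_of_toCompletion :
    Function.Injective ψ ∧ Set.range ψ = closure (toCompletion F '' (G : Set F)) := by
  obtain ⟨ι, hιc, hιi, hιη, hιr⟩ := exists_comparison G
  have h : ψ = ι := eq_of_toCompletion_eq G hψc hιc hψ hιη
  rw [h]
  exact ⟨hιi, hιr⟩

/-- **Range**: `range ψ = closure(η_F(G))`. [cite: Mochizuki2012, IUTchI Thm 2.6 p.57] -/
theorem range_eq_closure_of_toCompletion :
    Set.range ψ = closure (toCompletion F '' (G : Set F)) :=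
  (injective_and_range_eq_closure_of_toCompletion G hψc hψ).2

/-- `range ψ = U_G` as subgroups. [cite: Mochizuki2012, IUTchI Thm 2.6 p.57] -/
theorem range_eq_topologicalClosure_map_of_toCompletion :
    ψ.range = (G.map (toCompletion F)).topologicalClosure :=
  SetLike.coe_injective <| by
    rw [MonoidHom.coe_range, coe_topologicalClosure_map]
    exact range_eq_closure_of_toCompletion G hψc hψ

/-- Membership in the range, componentwise: `y ∈ range ψ ↔ ∀ N, y.val N ∈ G·N/N`.
[cite: Mochizuki2012, IUTchI Thm 2.6 p.57] -/
theorem mem_range_iff_forall_of_toCompletion (y : profiniteCompletion F) :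
    y ∈ Set.range ψ ↔
      ∀ N : FiniteIndexNormalSubgroup F, y.val N ∈ G.map (QuotientGroup.mk' N.toSubgroup) := by
  rw [range_eq_closure_of_toCompletion G hψc hψ]
  exact mem_closure_image_iff_forall

/-- `η_F(f) ∈ range ψ ↔ f ∈ G`. [cite: Mochizuki2012, IUTchI Thm 2.6 p.57] -/
theorem toCompletion_mem_range_iff_of_toCompletion (f : F) :
    toCompletion F f ∈ Set.range ψ ↔ f ∈ G := by
  rw [range_eq_closure_of_toCompletion G hψc hψ]
  exact toCompletion_mem_closure_image_iff G f

/-- The range of `ψ` is open in `F̂`. [cite: Mochizuki2012, IUTchI Thm 2.6 p.57] -/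
theorem isOpen_range_of_toCompletion : IsOpen (Set.range ψ) := by
  rw [range_eq_closure_of_toCompletion G hψc hψ]
  exact isOpen_closure_image G

/-- `ψ` is a closed embedding (continuous injection, compact source, Hausdorff target).
[cite: Mochizuki2012, IUTchI Thm 2.6 p.57] -/
theorem isClosedEmbedding_of_toCompletion : IsClosedEmbedding ψ :=
  hψc.isClosedEmbedding (injective_and_range_eq_closure_of_toCompletion G hψc hψ).1

/-- `ψ` commutes with closures: `closure (ψ '' s) = ψ '' closure s` (so e.g. the closure of a cyclic
subgroup `⟨η_G(x)⟩` of `Ĝ` is carried onto the closure of `⟨η_F(x)⟩` in `F̂`).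
[cite: Mochizuki2012, IUTchI Lem 2.7 p.59] -/
theorem closure_image_eq_of_toCompletion (s : Set (profiniteCompletion G)) :
    closure (ψ '' s) = ψ '' closure s :=
  (isClosedEmbedding_of_toCompletion G hψc hψ).closure_image_eq s

/-- Transport of closures of subsets of `G`: `ψ(closure η_G(S)) = closure η_F(S)`.
[cite: Mochizuki2012, IUTchI Lem 2.7 p.59] -/
theorem image_closure_image_toCompletion_of_toCompletion (S : Set G) :
    ψ '' closure (toCompletion G '' S) = closure (toCompletion F '' (Subtype.val '' S)) := by
  rw [← closure_image_eq_of_toCompletion G hψc hψ, Set.image_image, Set.image_image]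
  congr 1
  exact Set.image_congr fun g _ => hψ g

/-- Pull-back: every `z ∈ U_G` is `ψ w` for a unique `w ∈ Ĝ`. [cite: Mochizuki2012, IUTchI Lem 2.7 p.59] -/
theorem existsUnique_eq_of_mem_topologicalClosure_map {z : profiniteCompletion F}
    (hz : z ∈ (G.map (toCompletion F)).topologicalClosure) : ∃! w : profiniteCompletion G, ψ w = z := by
  rw [mem_topologicalClosure_map_iff, ← range_eq_closure_of_toCompletion G hψc hψ] at hz
  obtain ⟨w, rfl⟩ := hz
  exact ⟨w, rfl, fun w' hw' => (injective_and_range_eq_closure_of_toCompletion G hψc hψ).1 hw'⟩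

/-- **THE COMPARISON ISOMORPHISM.**  For `G ⊆ F` of finite index and `ψ : Ĝ → F̂` a continuous
homomorphism extending the inclusion, `ψ` induces a topological-group isomorphism
`e : Ĝ ≃ₜ* U_G = (G.map η_F).topologicalClosure` with `(e x : F̂) = ψ x`.
[cite: Mochizuki2012, IUTchI Thm 2.6 p.57] -/
theorem exists_continuousMulEquiv_of_toCompletion :
    ∃ e : profiniteCompletion G ≃ₜ* (G.map (toCompletion F)).topologicalClosure,
      ∀ x : profiniteCompletion G, ((e x : (G.map (toCompletion F)).topologicalClosure) :
        profiniteCompletion F) = ψ x := by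
  have hmem : ∀ x, ψ x ∈ (G.map (toCompletion F)).topologicalClosure := fun x => by
    rw [← range_eq_topologicalClosure_map_of_toCompletion G hψc hψ]
    exact ⟨x, rfl⟩
  let ψU : profiniteCompletion G →* (G.map (toCompletion F)).topologicalClosure :=
    ψ.codRestrict _ hmem
  have hψUc : Continuous ψU := hψc.subtype_mk hmem
  have hbij : Function.Bijective ψU := by
    refine ⟨fun x y hxy =>
      (injective_and_range_eq_closure_of_toCompletion G hψc hψ).1 (congrArg Subtype.val hxy), ?_⟩
    rintro ⟨z, hz⟩
    obtain ⟨w, hw, -⟩ := existsUnique_eq_of_mem_topologicalClosure_map G hψc hψ hz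
    exact ⟨w, Subtype.ext hw⟩
  let f : profiniteCompletion G ≃ₜ (G.map (toCompletion F)).topologicalClosure :=
    Continuous.homeoOfEquivCompactToT2 (f := Equiv.ofBijective ψU hbij) hψUc
  refine ⟨ContinuousMulEquiv.mk' f fun x y => ?_, fun x => rfl⟩
  change ψU (x * y) = ψU x * ψU y
  exact map_mul ψU x y

end Comparison

/-! ### Unconditional forms -/

/-- **`Ĝ ≅ closure(η_F(G))` as topological groups** for `G ⊆ F` of finite index: there is a
topological-group isomorphism `e : Ĝ ≃ₜ* (G.map η_F).topologicalClosure` extending the inclusion,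
`(e (η_G g) : F̂) = η_F g`. [cite: Mochizuki2012, IUTchI Thm 2.6 p.57] -/
theorem exists_continuousMulEquiv (G : Subgroup F) [G.FiniteIndex] :
    ∃ e : profiniteCompletion G ≃ₜ* (G.map (toCompletion F)).topologicalClosure,
      ∀ g : G, ((e (toCompletion G g) : (G.map (toCompletion F)).topologicalClosure) :
        profiniteCompletion F) = toCompletion F (g : F) := by
  obtain ⟨ι, hιc, -, hιη, -⟩ := exists_comparison G
  obtain ⟨e, he⟩ := exists_continuousMulEquiv_of_toCompletion G (ψ := ι) hιc hιη
  exact ⟨e, fun g => (he _).trans (hιη g)⟩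

/-- The same isomorphism realised by Mathlib's universal arrow `lift (η_F ∘ (G ⊆ F))`, BY NAME:
`e : Ĝ ≃ₜ* U_G` with `(e x : F̂) = lift(…) x` for all `x ∈ Ĝ`. [cite: Mochizuki2012, IUTchI Thm 2.6 p.57] -/
theorem exists_continuousMulEquiv_lift (G : Subgroup F) [G.FiniteIndex] :
    ∃ e : profiniteCompletion G ≃ₜ* (G.map (toCompletion F)).topologicalClosure,
      ∀ x : profiniteCompletion G, ((e x : (G.map (toCompletion F)).topologicalClosure) :
        profiniteCompletion F) =
        (ProfiniteCompletion.lift (G := GrpCat.of (G : Type u)) (P := profiniteCompletion F)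
          (GrpCat.ofHom ((toCompletion F).comp G.subtype))).hom x :=
  exists_continuousMulEquiv_of_toCompletion G
    (ψ := (ProfiniteCompletion.lift (G := GrpCat.of (G : Type u)) (P := profiniteCompletion F)
      (GrpCat.ofHom ((toCompletion F).comp G.subtype))).hom.toMonoidHom)
    (ProfiniteCompletion.lift (G := GrpCat.of (G : Type u)) (P := profiniteCompletion F)
      (GrpCat.ofHom ((toCompletion F).comp G.subtype))).hom.continuous_toFun
    (lift_toCompletion G)

/-- The functorial map `profiniteCompletion.map (G ⊆ F) : Ĝ → F̂` is injective with range
`closure(η_F(G))` for `G ⊆ F` of finite index. [cite: Mochizuki2012, IUTchI Thm 2.6 p.57] -/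
theorem profiniteCompletionMap_subtype_injective_and_range (G : Subgroup F) [G.FiniteIndex] :
    Function.Injective (ProfiniteGrp.profiniteCompletion.map (GrpCat.ofHom G.subtype)).hom ∧
      Set.range (ProfiniteGrp.profiniteCompletion.map (GrpCat.ofHom G.subtype)).hom =
        closure (toCompletion F '' (G : Set F)) :=
  injective_and_range_eq_closure_of_toCompletion G
    (ψ := (ProfiniteGrp.profiniteCompletion.map (GrpCat.ofHom G.subtype)).hom.toMonoidHom)
    (ProfiniteGrp.profiniteCompletion.map (GrpCat.ofHom G.subtype)).hom.continuous_toFun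
    (profiniteCompletionMap_toCompletion G.subtype)

end Literature.IUT.HodgeTheaters.ProfiniteCompletion
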